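import Summits.QuantumFields.BalabanUV.T4Continuum.Support.SpreadLift
import Summits.QuantumFields.BalabanUV.T4Continuum.Support.AveragingDeficitMultiLevelPrep

/-!
# ReplicationRightInverse (T⁴ programme, node NE3, crew row S6-Y7 (c) `replicationRightInverse`, file 5/6) — THE RIGHT INVERSE
# OF THE DIFFERENTIAL OF THE `(j+1)`-FOLD AVERAGE ALONG THE TOWER: `cpushIter j W (liftIter j W x φ) = φ` EXACTLY, ℝ-linear,
# `𝔲(N)`-valued, periodic, and road P3's (E0) decomposition `ψ = (ψ − liftIter (cpushIter ψ)) + liftIter (cpushIter ψ)` with the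
# first summand `TangentIter` (the `j`-uniform bound is file 6)

HONEST FRAMING (cell `pub-balaban`, T4-DAG PAGE 1; unit `b2b-balaban-t4-ne3-formalise-leaf-01` gen 3, NE3 (node U1b)
formalisation swarm, crew sub-row **S6-Y7 (c)** of `t4/formal/NE3/LEAVES.md` = leaf **L7(c) `replicationRightInverse`** of
the road-P3 skeleton `t4/skeletons/NE3-t4-ne3-p3.md` §2 («an explicit linear `Q_R` with `d(avgIter k)_U ∘ Q_R = id` …
corrected level by level; uses only the submersion structure and B7 (139)–(147)»); consumed in P3 §1 (E0):
«`X − Q_R·d(avgIter)_{U_A}[X] ∈ ker d(avgIter)_{U_A}`»).  The cell's T4 target is the finite-torus continuum limit of the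
unit-scale averaged loop expectations — NOT infinite volume, NO mass gap, NOT Clay, NOT summit progress.  All [folklore],
0 sorry, over `AveragingDeficitMultiLevelPrep` (`cavg`, `cpush`, `TangentIter`, `LevelSmall`, `radIter`, `tower`) and file 4's
one-level `SpreadLift.spreadInverse` BY NAME: §1 `cpushIter L j W` (the differential of the `(j+1)`-fold average as a map of
directions, by the SAME recursion as `TangentIter`) and **`tangentIter_iff_cpushIter_eq_zero`**; linearity `cpush_sub`; §2 the
smallness bookkeeping (`small512_of_levelSmall`); §3 **`liftIter`** — the composite of the one-level inverses down the tower —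
and **`cpushIter_liftIter`** (EXACT right inverse at every level), `crossSupported_liftIter`, `isSkewDir_liftIter`,
`isPeriodicDir_liftIter` (base period `L·L^j·M`, data period `M`), linearity `liftIter_add/smul/sub` and the bundled
`liftIterLin`; §4 **`tangentIter_sub_liftIter`**: `TangentIter L j W (ψ − liftIter L j W x (cpushIter L j W ψ))` for EVERY fine
direction `ψ` — road P3's (E0) decomposition.  File 6 `ReplicationRightInverseBound`: the pointwise bound
`‖liftIter L j W x φ (z,i)‖ ≤ liftConst j x·‖φ(⌊z/L^{j+1}⌋, i)‖` and its `j`-UNIFORM form `≤ 2‖φ(…)‖` for `L ≥ 2`.  CURRENCY NOTE (honest): the pointwise∕sup bound is uniform in `j`;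
counting `ℓ¹` sums carry the exact volume factor `L^{(d−1)}` PER LEVEL (file 4 `dirL1_spreadInverse_le`), uniform only after
volume weighting.  NOT NE3 in disguise: linear algebra of the averaging operators at ONE background tower; no minimiser, no
two-spacing comparison of minimisers, no rate, no energy norm (ρ19 clean).  NE3 is NOT proved by this file.
CITATION HEADER: no printed sentence is a hypothesis; the manuscripts under audit are not cited for any disputed step;
context: T. Bałaban, Commun. Math. Phys. **98** (1985) 17–51 [Balaban1985Averaging] ((42)–(43) p. 23, (139)–(147), (152)
p. 39–41); **102** (1985) 277–309 [Balaban1985Variational] ((83) p. 290, §E (115)–(121) p. 295).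
PLACEMENT: `Summits/QuantumFields/BalabanUV/` (human rule 2026-08-19).  Record: HOME `t4/formal/NE3/LEAVES.md` row S5∕S6.
-/

set_option autoImplicit false

open scoped BigOperators Matrix Matrix.Norms.L2Operator Topology
open NormedSpace Finset Filter

namespace Summit.QuantumFields.BalabanUV.T4Continuum.ReplicationRightInverse

open Literature.MathematicalPhysics.QuantumFieldTheory.Balaban1983to89
open B7Prop1Explicit B7Prop2Explicit MatrixLog UnitaryModel
open T4AveragingDeficitWall hiding Site Plane Plaq Bond
open T4AveragingDeficitWallBoundary (IsPeriodicCfg periodBox)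
open T4AveragingDeficitNonAbelian (Ad_mul Ad_sub)
open AveragingDeficitTransport AveragingDeficitLocality AveragingDeficitNearIdentity AveragingDeficitSideDeriv
open AveragingDeficitResidualPairing AveragingDeficitTransportCalc AveragingDeficitPushForwardLinear
open AveragingDeficitPeriodicCounting (IsPeriodicDir natCast_mul_period)
open AveragingDeficitLiftMap (LoopBound)
open AveragingDeficitChartCalculus (cavg)
open AveragingDeficitFermat (isPeriodicCfg_cavg small512_of_liftSmall)
open AveragingDeficitTwoLevelPrep (twoLevelSmall prop1Radius smallness_of_twoLevelSmall smallField_cavg cavg_isUnitaryCfg)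
open AveragingDeficitMultiLevelPrep (tower cpush TangentIter LevelSmall radIter isPeriodicDir_cpush natCast_tower_succ
  prop1Radius_nonneg)
open SkeletonLattice (cdiv cmod)
open SpreadLiftWords SpreadLiftDirection SpreadLiftMap SpreadLift

noncomputable section

variable {d : ℕ} {n : Type*} [Fintype n] [DecidableEq n]

/-! ## §1 The differential of the iterated average as a map of directions; tangency; linearity -/

/-- THE PUSH-FORWARD THROUGH `j + 1` AVERAGING STEPS, read on the coarse unit lattices, by the SAME recursion as `TangentIter`:
`cpushIter 0 W ψ = cpush L W ψ`, `cpushIter (j+1) W ψ = cpushIter j (cavg W) (cpush L W ψ)`. [cite: Balaban1985Averaging, (42)–(43) p.23] -/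
def cpushIter (L : ℕ) : ℕ → (Site d → Fin d → (Matrix n n ℂ)ˣ) → (Site d → Fin d → Matrix n n ℂ) → (Site d → Fin d → Matrix n n ℂ)
  | 0, W, ψ => cpush L W ψ
  | j + 1, W, ψ => cpushIter L j (cavg L W) (cpush L W ψ)

/-- **TANGENCY = KERNEL OF THE ITERATED PUSH-FORWARD**: `TangentIter L j W ψ ↔ cpushIter L j W ψ = 0`. [folklore] -/
theorem tangentIter_iff_cpushIter_eq_zero (L : ℕ) :
    ∀ (j : ℕ) (W : Site d → Fin d → (Matrix n n ℂ)ˣ) (ψ : Site d → Fin d → Matrix n n ℂ),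
      TangentIter L j W ψ ↔ cpushIter L j W ψ = 0
  | 0, _, _ => Iff.rfl
  | j + 1, W, ψ => tangentIter_iff_cpushIter_eq_zero L j (cavg L W) (cpush L W ψ)

/-- `cpush` is subtractive in the direction in the regime `|V(Γ_{c,x})V(c)⁻¹ − 1| ≤ 1/32`. [folklore] -/
theorem cpush_sub (L : ℕ) (W : Site d → Fin d → (Matrix n n ℂ)ˣ) {w : ℝ} (hw : w ≤ 1 / 32)
    (hW : ∀ (y : Site d) (κ : Fin d), LoopBound L W y κ w) (ψ ψ' : Site d → Fin d → Matrix n n ℂ) :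
    cpush L W (ψ - ψ') = cpush L W ψ - cpush L W ψ' := by
  funext y κ
  simp only [cpush, Pi.sub_apply]
  have hb : ∀ r : Fin d → Fin L, ‖((Wcx L W ((L : ℤ) • y) κ (boxVec L r) : (Matrix n n ℂ)ˣ) : Matrix n n ℂ) - 1‖ ≤ 1 / 32 :=
    fun r => (hW y κ r).trans hw
  rw [sub_eq_add_neg, pushDir_add L W _ _ _ κ hb, ← neg_one_smul ℝ ψ', pushDir_smul L W _ _ _ κ hb, neg_one_smul,
    ← sub_eq_add_neg]

/-! ## §2 Smallness bookkeeping along the tower -/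

omit [Fintype n] [DecidableEq n] in
/-- Every level of `LevelSmall` contains the standard smallness `512(d+1)(d+4)L²x ≤ 1`. [folklore] -/
theorem small512_of_levelSmall {L : ℕ} (hL : 1 ≤ L) {j : ℕ} {x : ℝ} (hx : 0 ≤ x) (hs : LevelSmall d L j x) :
    512 * (d + 1) * (d + 4) * (L : ℝ) ^ 2 * x ≤ 1 :=
  small512_of_liftSmall hL hx (smallness_of_twoLevelSmall (d := d) hL hx hs.two).1

omit [Fintype n] [DecidableEq n] in
/-- `LevelSmall (j+1) x` passes to the next level with the Prop. 1 radius. [folklore] -/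
theorem levelSmall_succ {L : ℕ} {j : ℕ} {x : ℝ} (hs : LevelSmall d L (j + 1) x) : LevelSmall d L j (prop1Radius d L x) := hs.2

/-! ## §3 The iterated right inverse -/

section Tower

variable [Nonempty n] {L : ℕ}

open Classical in
/-- The one-level inverse of file 4 as a PLAIN function of (configuration, radius, data): `spreadInverse` inside the regime
(`L ≥ 1`, `U(N)` data, `0 ≤ x`, `512(d+1)(d+4)L²x ≤ 1`, `|W(∂p) − 1| ≤ x`), zero outside. [folklore] -/
def spreadInverseFun (L : ℕ) (W : Site d → Fin d → (Matrix n n ℂ)ˣ) (x : ℝ) (φ : Site d → Fin d → Matrix n n ℂ) :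
    Site d → Fin d → Matrix n n ℂ :=
  if h : 1 ≤ L ∧ IsUnitaryCfg W ∧ 0 ≤ x ∧ 512 * (d + 1) * (d + 4) * (L : ℝ) ^ 2 * x ≤ 1 ∧ SmallField W x then
    spreadInverse h.1 h.2.1 h.2.2.1 h.2.2.2.1 h.2.2.2.2 φ
  else 0

/-- Inside the regime `spreadInverseFun` is `spreadInverse`. [folklore] -/
theorem spreadInverseFun_eq (hL : 1 ≤ L) {W : Site d → Fin d → (Matrix n n ℂ)ˣ} (hW : IsUnitaryCfg W) {x : ℝ} (hx : 0 ≤ x)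
    (h512 : 512 * (d + 1) * (d + 4) * (L : ℝ) ^ 2 * x ≤ 1) (hWx : SmallField W x) (φ : Site d → Fin d → Matrix n n ℂ) :
    spreadInverseFun L W x φ = spreadInverse hL hW hx h512 hWx φ := by
  unfold spreadInverseFun
  rw [dif_pos ⟨hL, hW, hx, h512, hWx⟩]

/-- **THE RIGHT INVERSE OF THE `(j+1)`-FOLD DIFFERENTIAL**: the composite of the one-level inverses down the tower,
`liftIter 0 W x = Q_W`, `liftIter (j+1) W x = Q_W ∘ liftIter j (cavg W) (prop1Radius x)` (the radius of `cavg W` is B7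
Prop. 1's). [cite: Balaban1985Averaging, (42)–(43) p.23, (139)–(147) p.39–40] -/
def liftIter (L : ℕ) : ℕ → (Site d → Fin d → (Matrix n n ℂ)ˣ) → ℝ → (Site d → Fin d → Matrix n n ℂ) →
    (Site d → Fin d → Matrix n n ℂ)
  | 0, W, x, φ => spreadInverseFun L W x φ
  | j + 1, W, x, φ => spreadInverseFun L W x (liftIter L j (cavg L W) (prop1Radius d L x) φ)

/-- The recursion step of `liftIter` inside the regime. [folklore] -/
theorem liftIter_succ (hL : 1 ≤ L) (j : ℕ) {W : Site d → Fin d → (Matrix n n ℂ)ˣ} {x : ℝ} (hW : IsUnitaryCfg W) (hx : 0 ≤ x)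
    (hs : LevelSmall d L (j + 1) x) (hWx : SmallField W x) (φ : Site d → Fin d → Matrix n n ℂ) :
    liftIter L (j + 1) W x φ
      = spreadInverse hL hW hx (small512_of_levelSmall hL hx hs) hWx (liftIter L j (cavg L W) (prop1Radius d L x) φ) := by
  show spreadInverseFun L W x _ = _
  rw [spreadInverseFun_eq hL hW hx (small512_of_levelSmall hL hx hs) hWx]

/-- The base of `liftIter` inside the regime. [folklore] -/
theorem liftIter_zero (hL : 1 ≤ L) {W : Site d → Fin d → (Matrix n n ℂ)ˣ} {x : ℝ} (hW : IsUnitaryCfg W) (hx : 0 ≤ x)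
    (hs : LevelSmall d L 0 x) (hWx : SmallField W x) (φ : Site d → Fin d → Matrix n n ℂ) :
    liftIter L 0 W x φ = spreadInverse hL hW hx (small512_of_levelSmall hL hx hs) hWx φ :=
  spreadInverseFun_eq hL hW hx (small512_of_levelSmall hL hx hs) hWx φ

/-- The data of the next level: `cavg W` is unitary, `prop1Radius x ≥ 0`, `LevelSmall j`, small-field. [folklore] -/
theorem next_level (hL : 1 ≤ L) {j : ℕ} {W : Site d → Fin d → (Matrix n n ℂ)ˣ} {x : ℝ} (hW : IsUnitaryCfg W) (hx : 0 ≤ x)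
    (hs : LevelSmall d L (j + 1) x) (hWx : SmallField W x) :
    IsUnitaryCfg (cavg L W) ∧ 0 ≤ prop1Radius d L x ∧ LevelSmall d L j (prop1Radius d L x)
      ∧ SmallField (cavg L W) (prop1Radius d L x) :=
  ⟨cavg_isUnitaryCfg hL hW hx (small512_of_levelSmall hL hx hs) hWx, prop1Radius_nonneg hx, levelSmall_succ hs,
    smallField_cavg hL hW hx (small512_of_levelSmall hL hx hs) hWx⟩

/-- **EXACT RIGHT INVERSE AT EVERY LEVEL**: `cpushIter L j W (liftIter L j W x φ) = φ`. [cite: Balaban1985Averaging, (42)–(43) p.23] -/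
theorem cpushIter_liftIter (hL : 1 ≤ L) (j : ℕ) : ∀ {W : Site d → Fin d → (Matrix n n ℂ)ˣ} {x : ℝ}, IsUnitaryCfg W → 0 ≤ x →
    LevelSmall d L j x → SmallField W x → ∀ (φ : Site d → Fin d → Matrix n n ℂ), cpushIter L j W (liftIter L j W x φ) = φ := by
  induction j with
  | zero =>
      intro W x hW hx hs hWx φ
      funext y κ
      show pushDir L W (liftIter L 0 W x φ) ((L : ℤ) • y) κ = φ y κ
      rw [liftIter_zero hL hW hx hs hWx]
      exact pushDir_spreadInverse hL hW hx _ hWx φ y κ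
  | succ j ih =>
      intro W x hW hx hs hWx φ
      obtain ⟨hW', hx', hs', hWx'⟩ := next_level hL hW hx hs hWx
      show cpushIter L j (cavg L W) (cpush L W (liftIter L (j + 1) W x φ)) = φ
      have h1 : cpush L W (liftIter L (j + 1) W x φ) = liftIter L j (cavg L W) (prop1Radius d L x) φ := by
        funext y κ
        rw [liftIter_succ hL j hW hx hs hWx]
        exact pushDir_spreadInverse hL hW hx _ hWx _ y κ
      rw [h1]
      exact ih hW' hx' hs' hWx' φ

/-- SUPPORT: the lift is supported on the crossing bonds of the finest lattice. [folklore] -/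
theorem crossSupported_liftIter (hL : 1 ≤ L) (j : ℕ) : ∀ {W : Site d → Fin d → (Matrix n n ℂ)ˣ} {x : ℝ}, IsUnitaryCfg W →
    0 ≤ x → LevelSmall d L j x → SmallField W x → ∀ (φ : Site d → Fin d → Matrix n n ℂ),
      CrossSupported L (liftIter L j W x φ) := by
  cases j with
  | zero =>
      intro W x hW hx hs hWx φ
      rw [liftIter_zero hL hW hx hs hWx]; exact crossSupported_spreadInverse hL hW hx _ hWx φ
  | succ j =>
      intro W x hW hx hs hWx φ
      rw [liftIter_succ hL j hW hx hs hWx]; exact crossSupported_spreadInverse hL hW hx _ hWx _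

/-- `𝔲(N)` data give a `𝔲(N)` direction at every level. [folklore] -/
theorem isSkewDir_liftIter (hL : 1 ≤ L) (j : ℕ) : ∀ {W : Site d → Fin d → (Matrix n n ℂ)ˣ} {x : ℝ}, IsUnitaryCfg W → 0 ≤ x →
    LevelSmall d L j x → SmallField W x → ∀ {φ : Site d → Fin d → Matrix n n ℂ},
    (∀ y κ, φ y κ ∈ skewAdjoint (Matrix n n ℂ)) → IsSkewDir (liftIter L j W x φ) := by
  induction j with
  | zero =>
      intro W x hW hx hs hWx φ hφ
      rw [liftIter_zero hL hW hx hs hWx]; exact isSkewDir_spreadInverse hL hW hx _ hWx hφ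
  | succ j ih =>
      intro W x hW hx hs hWx φ hφ
      obtain ⟨hW', hx', hs', hWx'⟩ := next_level hL hW hx hs hWx
      rw [liftIter_succ hL j hW hx hs hWx]
      exact isSkewDir_spreadInverse hL hW hx _ hWx (ih hW' hx' hs' hWx' hφ)

/-- **LINEARITY**: `liftIter` is additive in the data inside the regime. [folklore] -/
theorem liftIter_add (hL : 1 ≤ L) (j : ℕ) : ∀ {W : Site d → Fin d → (Matrix n n ℂ)ˣ} {x : ℝ}, IsUnitaryCfg W → 0 ≤ x →
    LevelSmall d L j x → SmallField W x → ∀ (φ φ' : Site d → Fin d → Matrix n n ℂ),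
    liftIter L j W x (φ + φ') = liftIter L j W x φ + liftIter L j W x φ' := by
  induction j with
  | zero =>
      intro W x hW hx hs hWx φ φ'
      simp only [liftIter_zero hL hW hx hs hWx, map_add]
  | succ j ih =>
      intro W x hW hx hs hWx φ φ'
      obtain ⟨hW', hx', hs', hWx'⟩ := next_level hL hW hx hs hWx
      simp only [liftIter_succ hL j hW hx hs hWx, ih hW' hx' hs' hWx', map_add]

/-- **LINEARITY**: `liftIter` is real-homogeneous in the data inside the regime. [folklore] -/
theorem liftIter_smul (hL : 1 ≤ L) (j : ℕ) : ∀ {W : Site d → Fin d → (Matrix n n ℂ)ˣ} {x : ℝ}, IsUnitaryCfg W → 0 ≤ x →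
    LevelSmall d L j x → SmallField W x → ∀ (c : ℝ) (φ : Site d → Fin d → Matrix n n ℂ),
    liftIter L j W x (c • φ) = c • liftIter L j W x φ := by
  induction j with
  | zero =>
      intro W x hW hx hs hWx c φ
      simp only [liftIter_zero hL hW hx hs hWx, map_smul]
  | succ j ih =>
      intro W x hW hx hs hWx c φ
      obtain ⟨hW', hx', hs', hWx'⟩ := next_level hL hW hx hs hWx
      simp only [liftIter_succ hL j hW hx hs hWx, ih hW' hx' hs' hWx', map_smul]

/-- `liftIter` is subtractive in the data inside the regime. [folklore] -/
theorem liftIter_sub (hL : 1 ≤ L) (j : ℕ) {W : Site d → Fin d → (Matrix n n ℂ)ˣ} {x : ℝ} (hW : IsUnitaryCfg W) (hx : 0 ≤ x)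
    (hs : LevelSmall d L j x) (hWx : SmallField W x) (φ φ' : Site d → Fin d → Matrix n n ℂ) :
    liftIter L j W x (φ - φ') = liftIter L j W x φ - liftIter L j W x φ' := by
  rw [sub_eq_add_neg, liftIter_add hL j hW hx hs hWx, ← neg_one_smul ℝ φ', liftIter_smul hL j hW hx hs hWx, neg_one_smul,
    ← sub_eq_add_neg]

/-- **THE RIGHT INVERSE AS A LINEAR MAP** (bundled, inside the regime). [folklore] -/
def liftIterLin (hL : 1 ≤ L) (j : ℕ) (W : Site d → Fin d → (Matrix n n ℂ)ˣ) (x : ℝ) (hW : IsUnitaryCfg W) (hx : 0 ≤ x)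
    (hs : LevelSmall d L j x) (hWx : SmallField W x) : (Site d → Fin d → Matrix n n ℂ) →ₗ[ℝ] (Site d → Fin d → Matrix n n ℂ) where
  toFun := liftIter L j W x
  map_add' := liftIter_add hL j hW hx hs hWx
  map_smul' := liftIter_smul hL j hW hx hs hWx

/-- `liftIterLin` is `liftIter`. [folklore] -/
theorem liftIterLin_apply (hL : 1 ≤ L) (j : ℕ) (W : Site d → Fin d → (Matrix n n ℂ)ˣ) (x : ℝ) (hW : IsUnitaryCfg W) (hx : 0 ≤ x)
    (hs : LevelSmall d L j x) (hWx : SmallField W x) (φ : Site d → Fin d → Matrix n n ℂ) :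
    liftIterLin hL j W x hW hx hs hWx φ = liftIter L j W x φ := rfl

/-- **PERIODICITY along the tower**: base `W` of period `L·tower L M j = L^{j+1}·M`, data `φ` of period `M` on the top unit
lattice ⇒ `liftIter L j W x φ` has period `L·tower L M j`. [folklore] -/
theorem isPeriodicDir_liftIter (hL : 1 ≤ L) (M : ℕ) (j : ℕ) : ∀ {W : Site d → Fin d → (Matrix n n ℂ)ˣ} {x : ℝ}, IsUnitaryCfg W →
    0 ≤ x → LevelSmall d L j x → SmallField W x → IsPeriodicCfg W ((L : ℤ) * (tower L M j : ℕ)) →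
    ∀ {φ : Site d → Fin d → Matrix n n ℂ}, (∀ (y : Site d) (i κ : Fin d), φ (y + (M : ℤ) • e i) κ = φ y κ) →
      IsPeriodicDir (liftIter L j W x φ) ((L : ℤ) * (tower L M j : ℕ)) := by
  induction j with
  | zero =>
      intro W x hW hx hs hWx hWP φ hφ
      rw [liftIter_zero hL hW hx hs hWx]; exact isPeriodicDir_spreadInverse hL hW hx _ hWx hWP hφ
  | succ j ih0 =>
      intro W x hW hx hs hWx hWP φ hφ
      obtain ⟨hW', hx', hs', hWx'⟩ := next_level hL hW hx hs hWx
      rw [liftIter_succ hL j hW hx hs hWx]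
      have hWP' : IsPeriodicCfg (cavg L W) ((L : ℤ) * (tower L M j : ℕ)) := by
        have h := isPeriodicCfg_cavg L (tower L M (j + 1)) hWP
        rw [natCast_tower_succ] at h
        exact h
      have ih := ih0 hW' hx' hs' hWx' hWP' hφ
      have hWP2 : IsPeriodicCfg W ((L : ℤ) * ((L * tower L M j : ℕ) : ℕ)) := by
        have e : ((L * tower L M j : ℕ) : ℤ) = (tower L M (j + 1) : ℕ) := by rw [natCast_tower_succ]; push_cast; ring
        rw [e]; exact hWP
      have h := isPeriodicDir_spreadInverse hL hW hx (small512_of_levelSmall hL hx hs) hWx (M := L * tower L M j) hWP2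
        (φ := liftIter L j (cavg L W) (prop1Radius d L x) φ)
        (fun y i κ => by have := ih y i κ; push_cast at this ⊢; exact this)
      rw [natCast_tower_succ]
      have e : (L : ℤ) * ((L * tower L M j : ℕ) : ℤ) = (L : ℤ) * ((L : ℤ) * (tower L M j : ℕ)) := by push_cast; ring
      rw [← e]; exact h

/-! ## §4 Road P3's (E0) decomposition: every direction is a tangent direction plus a lifted push-forward -/

/-- `cpushIter` is subtractive in the direction along a small-field unitary tower. [folklore] -/
theorem cpushIter_sub (hL : 1 ≤ L) (j : ℕ) : ∀ {W : Site d → Fin d → (Matrix n n ℂ)ˣ} {x : ℝ}, IsUnitaryCfg W → 0 ≤ x →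
    LevelSmall d L j x → SmallField W x → ∀ (ψ ψ' : Site d → Fin d → Matrix n n ℂ),
      cpushIter L j W (ψ - ψ') = cpushIter L j W ψ - cpushIter L j W ψ' := by
  induction j with
  | zero =>
      intro W x hW hx hs hWx ψ ψ'
      exact cpush_sub L W (loopRad_le (small512_of_levelSmall hL hx hs))
        (loopBound_of_smallField hL hW hx (small512_of_levelSmall hL hx hs) hWx) ψ ψ'
  | succ j ih =>
      intro W x hW hx hs hWx ψ ψ'
      obtain ⟨hW', hx', hs', hWx'⟩ := next_level hL hW hx hs hWx
      show cpushIter L j (cavg L W) (cpush L W (ψ - ψ'))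
        = cpushIter L j (cavg L W) (cpush L W ψ) - cpushIter L j (cavg L W) (cpush L W ψ')
      rw [cpush_sub L W (loopRad_le (small512_of_levelSmall hL hx hs))
        (loopBound_of_smallField hL hW hx (small512_of_levelSmall hL hx hs) hWx) ψ ψ']
      exact ih hW' hx' hs' hWx' _ _

/-- **(E0) DECOMPOSITION**: for EVERY fine direction `ψ`, `ψ − liftIter L j W x (cpushIter L j W ψ)` is tangent to the fibre of
the `(j+1)`-fold average (`TangentIter`), i.e. `ψ = tangent + liftIter (cpushIter ψ)`. [cite: Balaban1985Variational, (83) p.290] -/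
theorem tangentIter_sub_liftIter (hL : 1 ≤ L) (j : ℕ) {W : Site d → Fin d → (Matrix n n ℂ)ˣ} {x : ℝ} (hW : IsUnitaryCfg W)
    (hx : 0 ≤ x) (hs : LevelSmall d L j x) (hWx : SmallField W x) (ψ : Site d → Fin d → Matrix n n ℂ) :
    TangentIter L j W (ψ - liftIter L j W x (cpushIter L j W ψ)) := by
  rw [tangentIter_iff_cpushIter_eq_zero, cpushIter_sub hL j hW hx hs hWx, cpushIter_liftIter hL j hW hx hs hWx, sub_self]

end Tower

end

end Summit.QuantumFields.BalabanUV.T4Continuum.ReplicationRightInverse
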